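import Summits.ResolutionOfSingularities.ResolutionOfSingularities.Theorems.FrobeniusClosingSteerEventualStep
import Summits.ResolutionOfSingularities.ResolutionOfSingularities.Theorems.FrobeniusClosingSteerMonomialStageTrichotomy
import Summits.ResolutionOfSingularities.ResolutionOfSingularities.Theorems.FrobeniusClosingSteerCore4LowMultTwoCore
import Mathlib.RingTheory.Derivation.Basic
import HarnessLib

/-!
# Crux `Steer` (stmt-ResolutionOfSingularities-16345), line `switching_dichotomy` r24: SILENCE FORCES CRITICAL DIGITS
# (res-L0-w41-strat-1's helper N3 `CriticalDigitsOfSilence` for the (α) heart S3ᴹ)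

OURS (campaign `res-hironaka`, rung L ★L-G4, slot W4.1, chain W4.1; seat `res-L0-w41-stub-4` g3; Theses-free, definition-free helper
for the holder res-L0-w41-lead-1's line `switching_dichotomy` and strat-1's census (`L/res-L0-w41-strat-1/Sketch-census-section.lean`
§N3, «DISCHARGEABLE, size M, offered as a HELPER»); replaces the role of no printed item; NOT a statement of the manuscript under
review [claim: Hironaka2017, status: under-review]; AI-produced, which is weaker than expert review).

**`criticalDigitsOfSilence`** (strat-1's `CriticalDigitsOfSilence` with `CriticalDigits` / `ExitAt` / `GenAt` / `OrderOneGen` /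
`MonomialAt` UNFOLDED and `CoreDatum` reduced to the binders used: regularity at the centre, `ZeroDim`). Along a
cycle run `s j = μ j · (s (j+1) + c j)` of generators over members of the point sequence with NO EXIT at any member, the NEW UNIT
DIGIT `u_j := (s (j+1) + c j) ^ p ∈ R (Mj (j+1))` has ALL its derivatives in the centre: `v (δ u_j) < 1` for every derivation
`δ` of the member. ELEMENTARY proof (no structure theory of derivations): `s' := s (j+1) + c j` is a generator at
`S := R (Mj (j+1))` with UNIT radicand `u_j` (`v (c j) = 1 > v (s (j+1))`); the residue field of `S` is perfect (`ZeroDim`,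
perfect `k`), so `u_j − w ^ p ∈ 𝔪_S` for a unit `w`; were `δ u_j` a unit, then `δ (u_j − w ^ p) = δ u_j` (characteristic `p`) would
be a unit, whereas EVERY derivation maps `𝔪_S ^ 2` into `𝔪_S` — so `u_j − w ^ p ∈ 𝔪_S ∖ 𝔪_S ^ 2` is a regular parameter
(`LowMult.isRsopPart_one_of_not_mem_sq`) and `s'` is in ORDER-ONE FORM: an exit at `R (Mj (j+1))`, contradicting silence.
[folklore]
-/

-- `Summit.<S>.<S>.…` duplicates the summit name by design (single-problem summit).
set_option linter.dupNamespace false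

open IsLocalRing
open Literature.AlgebraicGeometry.Resolution

namespace Summit.ResolutionOfSingularities.ResolutionOfSingularities.Theorems.SwitchingDichotomy

namespace EventualMonomial

variable {k K : Type} [Field k] [Field K] [Algebra k K]

/-- **Derivations map `𝔪²` into `𝔪`** (Leibniz). [folklore] -/
theorem derivation_apply_mem_of_mem_sq {S : Type} [CommRing S] [IsLocalRing S] (δ : Derivation ℤ S S) {x : S}
    (hx : x ∈ maximalIdeal S ^ 2) : δ x ∈ maximalIdeal S := by
  rw [pow_two] at hx
  refine Submodule.mul_induction_on hx (fun a ha b hb => ?_) (fun y z hy hz => ?_)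
  · rw [Derivation.leibniz, smul_eq_mul, smul_eq_mul]
    exact Ideal.add_mem _ (Ideal.mul_mem_right _ _ ha) (Ideal.mul_mem_right _ _ hb)
  · rw [map_add]
    exact Ideal.add_mem _ hy hz

/-- **N3 · silence forces critical digits** (strat-1's `CriticalDigitsOfSilence`, vocabulary unfolded). [folklore] -/
theorem criticalDigitsOfSilence (p : ℕ) (hp : p.Prime) [CharP k p] [PerfectField k]
    (O : ValuationSubring K) (A₀ : Subalgebra k K) (h₀ : A₀.toSubring ≤ O.toSubring) (t : K)
    (hreg : IsRegularLocalRing (Localization.AtPrime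
      (Ideal.comap (Subring.inclusion h₀) (IsLocalRing.maximalIdeal O))))
    (hzd : ∀ x ∈ O, ∃ f : Polynomial k, f ≠ 0 ∧ Polynomial.aeval (R := k) x f ∈ O.nonunits)
    (R : ℕ → Subring K) (hR0 : R 0 = locAtCentre A₀.toSubring O)
    (hstep : ∀ i, IsQuadraticTransformAlong O (R i) (R (i + 1)))
    (hne : ∀ M, ¬ ∃ s' : K, (s' ^ p ∈ R M ∧ t ∈ Subring.closure (insert s' (R M : Set K))) ∧
      ∃ g ∈ R M, ∃ (_ : IsLocalRing (R M)) (z : Fin 1 → R M), IsRsopPart z ∧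
        ((z 0 : R M) : K) = s' ^ p - g ^ p)
    (Mj : ℕ → ℕ) (s μ c : ℕ → K) (_hMj : Monotone Mj)
    (hgen : ∀ j, (s j ^ p ∈ R (Mj j) ∧ t ∈ Subring.closure (insert (s j) (R (Mj j) : Set K))) ∧
      s j ≠ 0 ∧ O.valuation (s j ^ p) < 1)
    (hcyc : ∀ j, μ j ∈ R (Mj (j + 1)) ∧ c j ∈ R (Mj (j + 1)) ∧
      (∃ (_ : IsLocalRing (R (Mj (j + 1)))), ∃ (n : ℕ) (z : Fin n → R (Mj (j + 1))), IsRsopPart z ∧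
        ∃ (m : Fin n → ℕ) (u : R (Mj (j + 1))), IsUnit u ∧
          μ j = (∏ l, ((z l : R (Mj (j + 1))) : K) ^ m l) * (u : K)) ∧
      O.valuation (c j) = 1 ∧ O.valuation (μ j) < 1 ∧ s j = μ j * (s (j + 1) + c j)) :
    ∀ (j : ℕ) (u : R (Mj (j + 1))), (u : K) = (s (j + 1) + c j) ^ p →
      ∀ δ : Derivation ℤ (R (Mj (j + 1))) (R (Mj (j + 1))),
        O.valuation ((δ u : R (Mj (j + 1))) : K) < 1 := by
  classical
  haveI : Fact p.Prime := ⟨hp⟩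
  haveI : CharP K p := charP_of_injective_algebraMap (algebraMap k K).injective p
  intro j u hu δ
  -- facts along the sequence
  obtain ⟨hRreg, hRdom, hmono, -⟩ := sequence_facts O A₀ h₀ hreg R hR0 hstep
  have hSO : R (Mj (j + 1)) ≤ O.toSubring := (hRdom _).1
  have hk : ∀ a : k, algebraMap k K a ∈ R (Mj (j + 1)) := fun a =>
    hmono (Nat.zero_le _) (by rw [hR0]; exact le_locAtCentre _ O (A₀.algebraMap_mem a))
  obtain ⟨-, hcS, -, hvc, -, -⟩ := hcyc j
  -- the new generator `s' := s (j+1) + c j` and its unit radicand `u`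
  have hvs : O.valuation (s (j + 1)) < 1 := by
    by_contra hcon
    exact not_lt.mpr (one_le_pow₀ (n := p) (not_lt.mp hcon)) (by rw [← map_pow]; exact (hgen (j + 1)).2.2)
  have hvs' : O.valuation (s (j + 1) + c j) = 1 := by
    refine le_antisymm ?_ ?_
    · refine (Valuation.map_add _ _ _).trans ?_
      rw [hvc]
      exact max_le hvs.le le_rfl
    · by_contra hlt
      push Not at hlt
      have h1 : O.valuation (c j) ≤ max (O.valuation (s (j + 1) + c j)) (O.valuation (s (j + 1))) := by
        have h := Valuation.map_sub O.valuation (s (j + 1) + c j) (s (j + 1))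
        rwa [add_sub_cancel_left] at h
      rw [hvc] at h1
      exact not_lt.mpr h1 (max_lt hlt hvs)
  have hvu : O.valuation (u : K) = 1 := by rw [hu, map_pow, hvs', one_pow]
  have hu0 : (u : K) ≠ 0 := fun h => by simp [h] at hvu
  have hu_unit : IsUnit u := by
    rw [isUnit_subring_iff_inv_mem]
    refine ⟨hu0, (hRdom _).2 _ u.2 ((O.valuation_le_one_iff _).mp ?_)⟩
    rw [map_inv₀, hvu, inv_one]
  -- suppose the digit is not critical: `δ u` is a unit
  by_contra hcon
  have hδu1 : O.valuation ((δ u : R (Mj (j + 1))) : K) = 1 :=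
    le_antisymm ((O.valuation_le_one_iff _).mpr (hSO (δ u).2)) (not_lt.mp hcon)
  have hδu0 : ((δ u : R (Mj (j + 1))) : K) ≠ 0 := fun h => by simp [h] at hδu1
  have hδu : IsUnit (δ u) := by
    rw [isUnit_subring_iff_inv_mem]
    refine ⟨hδu0, (hRdom _).2 _ (δ u).2 ((O.valuation_le_one_iff _).mp ?_)⟩
    rw [map_inv₀, hδu1, inv_one]
  -- a residue `p`-th root `w` of `u`: `u - w ^ p ∈ 𝔪`
  haveI : PerfectField (ResidueField (R (Mj (j + 1)))) := MonomialStage.perfectField_residueField hzd (hRdom _) hk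
  obtain ⟨w, -, hwm⟩ := MonomialStage.exists_isUnit_sub_pow_mem_maximalIdeal (S := R (Mj (j + 1))) p hu_unit
  -- `δ (u - w ^ p) = δ u` is a unit, so `u - w ^ p ∉ 𝔪 ^ 2`
  have hδh : δ (u - w ^ p) = δ u := by
    rw [map_sub, Derivation.leibniz_pow, sub_eq_self]
    have : (p : R (Mj (j + 1))) = 0 := CharP.cast_eq_zero _ p
    rw [nsmul_eq_mul, this, zero_mul]
  have hnot2 : u - w ^ p ∉ maximalIdeal (R (Mj (j + 1))) ^ 2 := fun h2 => by
    have hmem : δ (u - w ^ p) ∈ maximalIdeal (R (Mj (j + 1))) := derivation_apply_mem_of_mem_sq δ h2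
    rw [hδh] at hmem
    exact (IsLocalRing.mem_maximalIdeal _).mp hmem hδu
  -- hence an ORDER-ONE exit at `R (Mj (j+1))` with the generator `s (j+1) + c j` and cleaner `w`
  have hz : IsRsopPart (fun _ : Fin 1 => u - w ^ p) := LowMult.isRsopPart_one_of_not_mem_sq hwm hnot2
  refine hne (Mj (j + 1)) ⟨s (j + 1) + c j, ⟨?_, ?_⟩, (w : K), w.2, inferInstance, fun _ => u - w ^ p, hz, ?_⟩
  · rw [← hu]; exact u.2
  · -- `t ∈ S[s (j+1)] ⊆ S[s (j+1) + c j]`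
    refine MonomialStage.closure_insert_le_of_mem ?_ (hgen (j + 1)).1.2
    have h1 : s (j + 1) + c j ∈ Subring.closure (insert (s (j + 1) + c j) (R (Mj (j + 1)) : Set K)) :=
      Subring.subset_closure (Set.mem_insert _ _)
    have h2 : c j ∈ Subring.closure (insert (s (j + 1) + c j) (R (Mj (j + 1)) : Set K)) :=
      Subring.subset_closure (Set.mem_insert_of_mem _ hcS)
    simpa using Subring.sub_mem _ h1 h2
  · push_cast
    rw [hu]

end EventualMonomial

end Summit.ResolutionOfSingularities.ResolutionOfSingularities.Theorems.SwitchingDichotomy
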